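import Mathlib

/-!
# `MatrixDescartes` census — rank-one `(2,4)₁`, lone letter: THE FOLD ALGEBRA OF THE MOMENT FORM
# (index form `𝒥`, the required-lone-weight derivative `Ξ′ = −2T𝒥/(Wⱼ𝒟)`, `𝒟 > 0` = the window, `S_{βg} < 0` = «lone letter fastest»,
# and the fold derivative `S₂²·𝒥′ = 2S₁·𝒞_W` — the cubic moment form that decides the `K = 4` lone-letter law)

HONEST FRAMING.  Object-search cell `pub-symmetroid`, seat `val-sym-mdr-p1` (generation 23); helper file `--supports` the crux item
stmt-ValiantsHypothesis-18050 (`Theses.LacunarySymmetroid.MatrixDescartes`, OPEN, on HOLD) with NO closure claim.  Companion of the `K = 4` programme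
`…CriticalWindowsFour*` (generation 22: Cramer frame, branch-0 function `φ`, its derivative).  PURE ALGEBRA (no definitions, no analysis, no count):
the identities below are the algebraic skeleton of a REDUCTION, located and cross-checked numerically in the seat memo MOMENT-FOLD.md, of the
fastest-lone-letter law («at most two critical directions of the four-letter window profile beyond the pivot letter») to ONE cubic inequality
`𝒞_W > 0` at fold points; that inequality is NOT proved here (nor anywhere yet).  Nothing here bears on `MatrixDescartes` in its window, on
`DoorA26` / `DoorA34`, registers / credences, or `VP ≠ VNP`.

SETTING (abstract weights).  Letters `0` (pivot, rate `−a`), `i, k` (rates `bᵢ, bₖ`), `j` (lone letter beyond the pivot, rate `bⱼ`) at positions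
`t₀, tᵢ, tₖ, tⱼ`; direction `T`; ARBITRARY real weights `W₀, Wᵢ, Wₖ, Wⱼ` (at a critical point of the profile `Wₘ = wₘ x^{dₘ}`).  Write `uₘ = T − tₘ`,
`Aₘ = T² − tₘ²`, and the sums `A = ∑Wₘ`, `S₁ = ∑βₘWₘuₘ`, `S₂ = ∑βₘ²Wₘuₘ²`, `S_{βg} = ∑βₘWₘAₘ`, `B₀ = ∑βₘWₘ`, `B₂ = ∑βₘ²Wₘuₘ`, `B₃ = ∑βₘ³Wₘuₘ²`
(`β = (−a, bᵢ, bₖ, bⱼ)`); the two critical equations are `(E1) ∑WₘAₘ = 0` and `(E2) ∑βₘWₘuₘ² = 0` (`…CriticalWindows`).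
MOMENT DICTIONARY (memo §1; not used formally): with the probability `δₘ ∝ Wₘuₘ²` and `gₘ = (T+tₘ)/(T−tₘ) = coth((log T − log tₘ)/2)`, (E1) ⟺ `E_δ g = 0`,
(E2) ⟺ `E_δ β = 0`, `𝒥 ∝ E[gβ]² − ½(E[g²]+1)E[β²]`, `𝒞_W ∝ E[β²]²·(3E[g²β] − 6κE[gβ²] + 2κ²E[β³])`, `κ = E[gβ]/E[β²]`; the Riccati identity
`∂ᵣ g = −(g²−1)/2` (`r = log T`) is what makes every derivative along a critical family polynomial in these moments.

WHAT IS PROVED (all by `ring` / `linear_combination` / sign bookkeeping).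
* §1 `hessianNumerator_eq_indexForm` — under (E1), (E2): `S₂·(2∑Wₘtₘ²) − S_{βg}² = −2T²·𝒥`, `𝒥 := 2S₁² − A·S₂` (THE INDEX FORM).  Since the profile
  `G(s,T) = ∑ wₘe^{βₘs}(T−tₘ)²/T` has `G_ss = S₂/T`, `G_TT = 2∑Wₘtₘ²/T³`, `G_sT = S_{βg}/T²`, this is `det Hess G = −2𝒥/T²`: a critical point is a local
  minimum of `G` (a local MINIMUM of the ψ-profile) iff `𝒥 < 0` and a saddle (a local MAXIMUM of the ψ-profile) iff `𝒥 > 0`; `𝒥 = 0` is the FOLD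
  (birth of a pair).  [memo §2; checked at 670/670 located critical points]
* §2 `xiDeriv_identity` — THE REQUIRED LONE WEIGHT.  Along the branch-0 function `x = φ(T)` of `…FourBranchZero` (weights `w₀, wᵢ, wₖ` fixed) let
  `Ξ(T)` be the logarithm of the lone weight `wⱼ` that makes `T` critical, `q = φ′/φ`, `ξ = Ξ′`, and exponents `dₘ = c + λβₘ` (the pencil coupling).
  Differentiating (E1), (E2) in `T` gives the displayed 2 × 2 linear system for `(q, ξ)`; Cramer plus (E1), (E2) give `ξ·λ·Wⱼ·𝒟 = −2T·λ·𝒥` with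
  `𝒟 := bⱼuⱼ²·S_{βg} + (tⱼ²−T²)·S₂`.  So the critical points of `Ξ` are exactly the fold points, `Ξ′ < 0` at local maxima of the ψ-profile and `Ξ′ > 0`
  at local minima (given §3, §4).  [memo §3]
* §3 `foldDenominator_pos` — `𝒟 > 0` for positive weights on the right window: termwise, the letter-`0` term is `a·W₀u₀|uⱼ|·[a(T−t₀)(T+tⱼ) − bⱼ(tⱼ−T)(T+t₀)]`,
  i.e. EXACTLY the window inequality of `…CriticalWindows`; in moment language `𝒟 > 0 ⟺ gⱼ − κbⱼ < 0`.  [memo §3]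
* §4 `mixedMoment_neg_of_fastest` — under (E1), `T > t₀ > tᵢ, tₖ` and `bⱼ > bᵢ, bₖ`: `S_{βg} = ∑(βₘ − bⱼ)WₘAₘ < 0` (so `κ < 0`: the lone letter
  FASTEST makes `g` and `β` negatively correlated under `δ`).  [memo §3]
* §5 `coupled_sums` — the jet identities `∑dₘWₘAₘ = c·(E1) + λS_{βg}`, `∑βₘdₘWₘuₘ² = c·(E2) + λS₂`, `∑βₘdₘWₘuₘ = cS₁ + λB₂`, `∑dₘWₘ = cA + λB₀`,
  `∑βₘ²dₘWₘuₘ² = cS₂ + λB₃`, `S_{βg} = 2T·S₁ − (E2)` (bookkeeping for the derivative of `𝒥` along the branch). [folklore]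
* **§6 `indexFormDeriv_at_fold` — THE FOLD DERIVATIVE.**  In abstract symbols: if `q·λ·S₂ = −2S₁` (the `q`-equation at a critical point of `Ξ`) and
  `A·S₂ = 2S₁²` (fold), then `S₂²·𝒥′ = 2S₁·𝒞_W` where `𝒥′ := 4S₁(q(cS₁+λB₂) + B₀) − q(cA+λB₀)S₂ − A(q(cS₂+λB₃) + 2B₂)` is the `T`-derivative of `𝒥`
  along the branch (`dWₘ/dT = dₘqWₘ`, `duₘ/dT = 1`) and **`𝒞_W := 3B₀S₂² − 6B₂S₁S₂ + 2B₃S₁²`** (the constant `c` drops out by the fold relation).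
  CONSEQUENCE (memo §4, analytic assembly NOT in this file): `Ξ″ = 4T|S₁|·𝒞_W/(S₂²Wⱼ𝒟)` at every critical point of `Ξ`, so «`𝒞_W > 0` at fold points» ⇒
  every critical point of `Ξ` is a nondegenerate minimum ⇒ `Ξ` has at most one critical point on the window ⇒ each lone weight is required by at
  most two directions ⇒ the `K = 4` fastest-lone-letter law.  LOCATED ONLY: `𝒞_W > 0` at 300/300 fold points of random pencils (normalised margin
  ≥ 0.59) and, in abstract moment space (any number of left letters), 0 violations in ≈ 10⁶ samples — see the memo for the exact hypothesis set.
[folklore] Linear algebra of 2 × 2 systems, polynomial identities.  No definitions, no named facts, no analysis.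
-/

-- `Summit.ValiantsHypothesis.ValiantsHypothesis.…` repeats a component by the D-0017 layout
-- (single-conjunct summit), which the `dupNamespace` linter flags; the name is mandated.
set_option linter.dupNamespace false

namespace Summit.ValiantsHypothesis.ValiantsHypothesis.Theorems.LacunarySymmetroidMatrixDescartes.Pivot.CriticalWindows.Four

/-! ## 1. The index form: the Hessian numerator of the profile at a critical point -/

/-- **HESSIAN NUMERATOR = −2T²·(INDEX FORM).**  Under the two critical equations (E1) `∑WₘAₘ = 0`, (E2) `∑βₘWₘuₘ² = 0`:
`S₂·(2∑Wₘtₘ²) − S_{βg}² = −2T²·(2S₁² − A·S₂)`.  (With `G_ss = S₂/T`, `G_TT = 2∑Wₘtₘ²/T³`, `G_sT = S_{βg}/T²` this is `T⁴·det Hess G = −2T²𝒥`.) [folklore] -/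
theorem hessianNumerator_eq_indexForm (W₀ Wi Wk Wj a bi bk bj t₀ ti tk tj T : ℝ)
    (h1 : W₀ * (T ^ 2 - t₀ ^ 2) + Wi * (T ^ 2 - ti ^ 2) + Wk * (T ^ 2 - tk ^ 2) + Wj * (T ^ 2 - tj ^ 2) = 0)
    (h2 : (-a) * W₀ * (T - t₀) ^ 2 + bi * Wi * (T - ti) ^ 2 + bk * Wk * (T - tk) ^ 2 + bj * Wj * (T - tj) ^ 2 = 0) :
    ((-a) ^ 2 * W₀ * (T - t₀) ^ 2 + bi ^ 2 * Wi * (T - ti) ^ 2 + bk ^ 2 * Wk * (T - tk) ^ 2 + bj ^ 2 * Wj * (T - tj) ^ 2) * (2 * (W₀ * t₀ ^ 2 + Wi * ti ^ 2 + Wk * tk ^ 2 + Wj * tj ^ 2)) - ((-a) * W₀ * (T ^ 2 - t₀ ^ 2) + bi * Wi * (T ^ 2 - ti ^ 2) + bk * Wk * (T ^ 2 - tk ^ 2) + bj * Wj * (T ^ 2 - tj ^ 2)) ^ 2 = -(2 * T ^ 2) * (2 * ((-a) * W₀ * (T - t₀) + bi * Wi * (T - ti) + bk * Wk * (T - tk)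 + bj * Wj * (T - tj)) ^ 2 - (W₀ + Wi + Wk + Wj) * ((-a) ^ 2 * W₀ * (T - t₀) ^ 2 + bi ^ 2 * Wi * (T - ti) ^ 2 + bk ^ 2 * Wk * (T - tk) ^ 2 + bj ^ 2 * Wj * (T - tj) ^ 2)) := by
  linear_combination (-2 * ((-a) ^ 2 * W₀ * (T - t₀) ^ 2 + bi ^ 2 * Wi * (T - ti) ^ 2 + bk ^ 2 * Wk * (T - tk) ^ 2 + bj ^ 2 * Wj * (T - tj) ^ 2)) * h1 + (4 * T * ((-a) * W₀ * (T - t₀) + bi * Wi * (T - ti) + bk * Wk * (T - tk) + bj * Wj * (T - tj)) - ((-a) * W₀ * (T - t₀) ^ 2 + bi * Wi * (T - ti) ^ 2 + bk * Wk * (T - tk) ^ 2 + bj * Wj * (T - tj) ^ 2)) * h2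


/-! ## 2. The derivative of the required lone weight -/

/-- **CRAMER FOR THE DIFFERENTIATED CRITICAL EQUATIONS.**  If `P·q + Q·ξ = α` and `R·q + S·ξ = β` then `ξ·(P·S − Q·R) = P·β − R·α`. [folklore] -/
theorem cramer_second_unknown {P Q R S q ξ α β : ℝ} (h1 : P * q + Q * ξ = α) (h2 : R * q + S * ξ = β) :
    ξ * (P * S - Q * R) = P * β - R * α := by
  linear_combination (-R) * h1 + P * h2

/-- **`Ξ′·λWⱼ𝒟 = −2Tλ·𝒥`.**  Exponents `dₘ = c + λβₘ`; along a branch `T ↦ (x(T), wⱼ(T))` on which (E1), (E2) hold identically, with `q = x′/x`,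
`ξ = wⱼ′/wⱼ` (so `dWₘ/dT = dₘqWₘ` for `m ≠ j`, `dWⱼ/dT = (dⱼq + ξ)Wⱼ`, `duₘ/dT = 1`, `dAₘ/dT = 2T`), the `T`-derivatives of (E1), (E2) are the two
displayed linear equations; together with (E1), (E2) themselves they give `ξ·(λ·Wⱼ·𝒟) = −2T·λ·𝒥`, `𝒟 = bⱼuⱼ²S_{βg} + (tⱼ²−T²)S₂`, `𝒥 = 2S₁² − AS₂`. [folklore] -/
theorem xiDeriv_identity (W₀ Wi Wk Wj a bi bk bj t₀ ti tk tj T c lam q ξ : ℝ)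
    (h1 : W₀ * (T ^ 2 - t₀ ^ 2) + Wi * (T ^ 2 - ti ^ 2) + Wk * (T ^ 2 - tk ^ 2) + Wj * (T ^ 2 - tj ^ 2) = 0)
    (h2 : (-a) * W₀ * (T - t₀) ^ 2 + bi * Wi * (T - ti) ^ 2 + bk * Wk * (T - tk) ^ 2 + bj * Wj * (T - tj) ^ 2 = 0)
    (hlin1 : ((c + lam * (-a)) * W₀ * (T ^ 2 - t₀ ^ 2) + (c + lam * bi) * Wi * (T ^ 2 - ti ^ 2) + (c + lam * bk) * Wk * (T ^ 2 - tk ^ 2) + (c + lam * bj) * Wj * (T ^ 2 - tj ^ 2)) * q + (Wj * (T ^ 2 - tj ^ 2)) * ξ = -(2 * T) * (W₀ + Wi + Wk + Wj))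
    (hlin2 : ((-a) * (c + lam * (-a)) * W₀ * (T - t₀) ^ 2 + bi * (c + lam * bi) * Wi * (T - ti) ^ 2 + bk * (c + lam * bk) * Wk * (T - tk) ^ 2 + bj * (c + lam * bj) * Wj * (T - tj) ^ 2) * q + (bj * Wj * (T - tj) ^ 2) * ξ = -2 * ((-a) * W₀ * (T - t₀) + bi * Wi * (T - ti) + bk * Wk * (T - tk) + bj * Wj * (T - tj))) :
    ξ * (lam * Wj * (bj * (T - tj) ^ 2 * ((-a) * W₀ * (T ^ 2 - t₀ ^ 2) + bi * Wi * (T ^ 2 - ti ^ 2) + bk * Wk * (T ^ 2 - tk ^ 2) + bj * Wj * (T ^ 2 - tj ^ 2)) + (tj ^ 2 - T ^ 2) * ((-a) ^ 2 * W₀ * (T - t₀) ^ 2 + bi ^ 2 * Wi * (T - ti) ^ 2 + bk ^ 2 * Wk * (T - tk) ^ 2 + bj ^ 2 * Wj * (T - tj) ^ 2))) = -(2 * T) * lam * (2 * ((-a) * W₀ * (T - t₀) + bi * Wi * (T - ti) + bk * Wk * (T - tk) + bj * Wj * (T - tj)) ^ 2 - (W₀ + Wi + Wk + Wj) * ((-a)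 ^ 2 * W₀ * (T - t₀) ^ 2 + bi ^ 2 * Wi * (T - ti) ^ 2 + bk ^ 2 * Wk * (T - tk) ^ 2 + bj ^ 2 * Wj * (T - tj) ^ 2)) := by
  have hc := cramer_second_unknown hlin1 hlin2
  linear_combination hc + (-(ξ * c * Wj * (bj * (T - tj) ^ 2)) - 2 * c * ((-a) * W₀ * (T - t₀) + bi * Wi * (T - ti) + bk * Wk * (T - tk) + bj * Wj * (T - tj))) * h1
    + (ξ * c * Wj * (T ^ 2 - tj ^ 2) + 2 * lam * ((-a) * W₀ * (T - t₀) + bi * Wi * (T - ti) + bk * Wk * (T - tk) + bj * Wj * (T - tj)) + 2 * c * T * (W₀ + Wi + Wk + Wj)) * h2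


/-! ## 3. The denominator is positive on the window (= the window inequality) -/

/-- **TERMWISE FORM OF `𝒟`.**  `𝒟 = Wᵢ·[…] + Wₖ·[…] + W₀·a(T−t₀)(tⱼ−T)·[a(T−t₀)(tⱼ+T) − bⱼ(tⱼ−T)(T+t₀)]`, the `Wⱼ`-term vanishing. [folklore] -/
theorem foldDenominator_termwise (W₀ Wi Wk Wj a bi bk bj t₀ ti tk tj T : ℝ) :
    (bj * (T - tj) ^ 2 * ((-a) * W₀ * (T ^ 2 - t₀ ^ 2) + bi * Wi * (T ^ 2 - ti ^ 2) + bk * Wk * (T ^ 2 - tk ^ 2) + bj * Wj * (T ^ 2 - tj ^ 2)) + (tj ^ 2 - T ^ 2) * ((-a) ^ 2 * W₀ * (T - t₀) ^ 2 + bi ^ 2 * Wi * (T - ti) ^ 2 + bk ^ 2 * Wk * (T - tk) ^ 2 + bj ^ 2 * Wj * (T - tj) ^ 2))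
      = Wi * (bj * (T - tj) ^ 2 * (bi * (T ^ 2 - ti ^ 2)) + (tj ^ 2 - T ^ 2) * (bi ^ 2 * (T - ti) ^ 2))
        + Wk * (bj * (T - tj) ^ 2 * (bk * (T ^ 2 - tk ^ 2)) + (tj ^ 2 - T ^ 2) * (bk ^ 2 * (T - tk) ^ 2))
        + W₀ * (a * (T - t₀) * (tj - T) * (a * (T - t₀) * (tj + T) - bj * (tj - T) * (T + t₀))) := by
  ring

/-- **`𝒟 > 0` ON THE RIGHT WINDOW.**  For positive weights, positive rates, `0 < tᵢ, tₖ < t₀ < T < tⱼ` and the window inequality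
`bⱼ(T+t₀)(tⱼ−T) < a(T−t₀)(tⱼ+T)` (`…CriticalWindows.exists_window_of_critical_right`): `𝒟 > 0`. [folklore] -/
theorem foldDenominator_pos {W₀ Wi Wk Wj a bi bk bj t₀ ti tk tj T : ℝ} (hW₀ : 0 < W₀) (hWi : 0 < Wi) (hWk : 0 < Wk)
    (ha : 0 < a) (hbi : 0 < bi) (hbk : 0 < bk) (hbj : 0 < bj) (hti : 0 < ti) (htk : 0 < tk) (hi0 : ti < t₀) (hk0 : tk < t₀)
    (h0T : t₀ < T) (hTj : T < tj) (hwin : bj * (T + t₀) * (tj - T) < a * (T - t₀) * (tj + T)) :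
    0 < (bj * (T - tj) ^ 2 * ((-a) * W₀ * (T ^ 2 - t₀ ^ 2) + bi * Wi * (T ^ 2 - ti ^ 2) + bk * Wk * (T ^ 2 - tk ^ 2) + bj * Wj * (T ^ 2 - tj ^ 2)) + (tj ^ 2 - T ^ 2) * ((-a) ^ 2 * W₀ * (T - t₀) ^ 2 + bi ^ 2 * Wi * (T - ti) ^ 2 + bk ^ 2 * Wk * (T - tk) ^ 2 + bj ^ 2 * Wj * (T - tj) ^ 2)) := by
  rw [foldDenominator_termwise W₀ Wi Wk Wj a bi bk bj t₀ ti tk tj T]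
  have li : 0 < T - ti := by linarith
  have lk : 0 < T - tk := by linarith
  have l0 : 0 < T - t₀ := by linarith
  have lj : 0 < tj - T := by linarith
  have hAi : 0 < T ^ 2 - ti ^ 2 := by nlinarith
  have hAk : 0 < T ^ 2 - tk ^ 2 := by nlinarith
  have hAj : 0 < tj ^ 2 - T ^ 2 := by nlinarith
  have hsq : 0 < (T - tj) ^ 2 := by nlinarith [mul_pos lj lj]
  have ti1 : 0 < Wi * (bj * (T - tj) ^ 2 * (bi * (T ^ 2 - ti ^ 2)) + (tj ^ 2 - T ^ 2) * (bi ^ 2 * (T - ti) ^ 2)) := by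
    apply mul_pos hWi
    have : 0 < bj * (T - tj) ^ 2 * (bi * (T ^ 2 - ti ^ 2)) := mul_pos (mul_pos hbj hsq) (mul_pos hbi hAi)
    have : 0 < (tj ^ 2 - T ^ 2) * (bi ^ 2 * (T - ti) ^ 2) := mul_pos hAj (mul_pos (pow_pos hbi 2) (pow_pos li 2))
    linarith
  have tk1 : 0 < Wk * (bj * (T - tj) ^ 2 * (bk * (T ^ 2 - tk ^ 2)) + (tj ^ 2 - T ^ 2) * (bk ^ 2 * (T - tk) ^ 2)) := by
    apply mul_pos hWk
    have : 0 < bj * (T - tj) ^ 2 * (bk * (T ^ 2 - tk ^ 2)) := mul_pos (mul_pos hbj hsq) (mul_pos hbk hAk)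
    have : 0 < (tj ^ 2 - T ^ 2) * (bk ^ 2 * (T - tk) ^ 2) := mul_pos hAj (mul_pos (pow_pos hbk 2) (pow_pos lk 2))
    linarith
  have t01 : 0 < W₀ * (a * (T - t₀) * (tj - T) * (a * (T - t₀) * (tj + T) - bj * (tj - T) * (T + t₀))) := by
    apply mul_pos hW₀
    have hb : 0 < a * (T - t₀) * (tj + T) - bj * (tj - T) * (T + t₀) := by nlinarith
    exact mul_pos (mul_pos (mul_pos ha l0) lj) hb
  linarith


/-! ## 4. The mixed moment is negative when the lone letter is fastest -/

/-- **`S_{βg} = ∑(βₘ − bⱼ)WₘAₘ + bⱼ·(E1)`**, hence under (E1), `T > t₀ > tᵢ, tₖ > 0`, positive weights and `bⱼ > bᵢ, bₖ` (`a > 0`): `S_{βg} < 0`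
(in moment language `E_δ[gβ] < 0`, `κ < 0`). [folklore] -/
theorem mixedMoment_neg_of_fastest {W₀ Wi Wk Wj a bi bk bj t₀ ti tk tj T : ℝ} (hW₀ : 0 < W₀) (hWi : 0 < Wi) (hWk : 0 < Wk)
    (ha : 0 < a) (hbj : 0 < bj) (hti : 0 < ti) (htk : 0 < tk) (hi0 : ti < t₀) (hk0 : tk < t₀) (h0T : t₀ < T)
    (hij : bi < bj) (hkj : bk < bj)
    (h1 : W₀ * (T ^ 2 - t₀ ^ 2) + Wi * (T ^ 2 - ti ^ 2) + Wk * (T ^ 2 - tk ^ 2) + Wj * (T ^ 2 - tj ^ 2) = 0) :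
    (-a) * W₀ * (T ^ 2 - t₀ ^ 2) + bi * Wi * (T ^ 2 - ti ^ 2) + bk * Wk * (T ^ 2 - tk ^ 2) + bj * Wj * (T ^ 2 - tj ^ 2) < 0 := by
  have e : (-a) * W₀ * (T ^ 2 - t₀ ^ 2) + bi * Wi * (T ^ 2 - ti ^ 2) + bk * Wk * (T ^ 2 - tk ^ 2) + bj * Wj * (T ^ 2 - tj ^ 2)
      = (-a - bj) * W₀ * (T ^ 2 - t₀ ^ 2) + (bi - bj) * Wi * (T ^ 2 - ti ^ 2) + (bk - bj) * Wk * (T ^ 2 - tk ^ 2)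
        + bj * (W₀ * (T ^ 2 - t₀ ^ 2) + Wi * (T ^ 2 - ti ^ 2) + Wk * (T ^ 2 - tk ^ 2) + Wj * (T ^ 2 - tj ^ 2)) := by ring
  rw [e, h1, mul_zero, add_zero]
  have hA0 : 0 < T ^ 2 - t₀ ^ 2 := by nlinarith
  have hAi : 0 < T ^ 2 - ti ^ 2 := by nlinarith
  have hAk : 0 < T ^ 2 - tk ^ 2 := by nlinarith
  have t1 : (-a - bj) * W₀ * (T ^ 2 - t₀ ^ 2) < 0 :=
    mul_neg_of_neg_of_pos (mul_neg_of_neg_of_pos (by linarith) hW₀) hA0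
  have t2 : (bi - bj) * Wi * (T ^ 2 - ti ^ 2) < 0 :=
    mul_neg_of_neg_of_pos (mul_neg_of_neg_of_pos (by linarith) hWi) hAi
  have t3 : (bk - bj) * Wk * (T ^ 2 - tk ^ 2) < 0 :=
    mul_neg_of_neg_of_pos (mul_neg_of_neg_of_pos (by linarith) hWk) hAk
  linarith


/-! ## 5. Jet identities for the coupled exponents -/

/-- **COUPLED SUMS.**  With `dₘ = c + λβₘ`: `∑dₘWₘAₘ = c·∑WₘAₘ + λS_{βg}`, `∑βₘdₘWₘuₘ² = c·∑βₘWₘuₘ² + λS₂`, `∑βₘdₘWₘuₘ = cS₁ + λB₂`,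
`∑dₘWₘ = cA + λB₀`, `∑βₘ²dₘWₘuₘ² = cS₂ + λB₃`, and `S_{βg} = 2T·S₁ − ∑βₘWₘuₘ²`. [folklore] -/
theorem coupled_sums (W₀ Wi Wk Wj a bi bk bj t₀ ti tk tj T c lam : ℝ) :
    ((c + lam * (-a)) * W₀ * (T ^ 2 - t₀ ^ 2) + (c + lam * bi) * Wi * (T ^ 2 - ti ^ 2) + (c + lam * bk) * Wk * (T ^ 2 - tk ^ 2) + (c + lam * bj) * Wj * (T ^ 2 - tj ^ 2)) = c * (W₀ * (T ^ 2 - t₀ ^ 2) + Wi * (T ^ 2 - ti ^ 2) + Wk * (T ^ 2 - tk ^ 2) + Wj * (T ^ 2 - tj ^ 2)) + lam * ((-a) * W₀ * (T ^ 2 - t₀ ^ 2) + bi * Wi * (T ^ 2 - ti ^ 2) + bk * Wk * (T ^ 2 - tk ^ 2) + bj * Wj * (T ^ 2 - tj ^ 2)) ∧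
    ((-a) * (c + lam * (-a)) * W₀ * (T - t₀) ^ 2 + bi * (c + lam * bi) * Wi * (T - ti) ^ 2 + bk * (c + lam * bk) * Wk * (T - tk) ^ 2 + bj * (c + lam * bj) * Wj * (T - tj) ^ 2) = c * ((-a) * W₀ * (T - t₀) ^ 2 + bi * Wi * (T - ti) ^ 2 + bk * Wk * (T - tk) ^ 2 + bj * Wj * (T - tj) ^ 2) + lam * ((-a) ^ 2 * W₀ * (T - t₀) ^ 2 + bi ^ 2 * Wi * (T - ti) ^ 2 + bk ^ 2 * Wk * (T - tk) ^ 2 + bj ^ 2 * Wj * (T - tj) ^ 2) ∧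
    ((-a) * (c + lam * (-a)) * W₀ * (T - t₀) + bi * (c + lam * bi) * Wi * (T - ti) + bk * (c + lam * bk) * Wk * (T - tk)
        + bj * (c + lam * bj) * Wj * (T - tj)) = c * ((-a) * W₀ * (T - t₀) + bi * Wi * (T - ti) + bk * Wk * (T - tk) + bj * Wj * (T - tj)) + lam * ((-a) ^ 2 * W₀ * (T - t₀) + bi ^ 2 * Wi * (T - ti) + bk ^ 2 * Wk * (T - tk) + bj ^ 2 * Wj * (T - tj)) ∧
    ((c + lam * (-a)) * W₀ + (c + lam * bi) * Wi + (c + lam * bk) * Wk + (c + lam * bj) * Wj) = c * (W₀ + Wi + Wk + Wj) + lam * ((-a) * W₀ + bi * Wi + bk * Wk + bj * Wj) ∧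
    ((-a) ^ 2 * (c + lam * (-a)) * W₀ * (T - t₀) ^ 2 + bi ^ 2 * (c + lam * bi) * Wi * (T - ti) ^ 2
        + bk ^ 2 * (c + lam * bk) * Wk * (T - tk) ^ 2 + bj ^ 2 * (c + lam * bj) * Wj * (T - tj) ^ 2) = c * ((-a) ^ 2 * W₀ * (T - t₀) ^ 2 + bi ^ 2 * Wi * (T - ti) ^ 2 + bk ^ 2 * Wk * (T - tk) ^ 2 + bj ^ 2 * Wj * (T - tj) ^ 2) + lam * ((-a) ^ 3 * W₀ * (T - t₀) ^ 2 + bi ^ 3 * Wi * (T - ti) ^ 2 + bk ^ 3 * Wk * (T - tk) ^ 2 + bj ^ 3 * Wj * (T - tj) ^ 2) ∧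
    ((-a) * W₀ * (T ^ 2 - t₀ ^ 2) + bi * Wi * (T ^ 2 - ti ^ 2) + bk * Wk * (T ^ 2 - tk ^ 2) + bj * Wj * (T ^ 2 - tj ^ 2)) = 2 * T * ((-a) * W₀ * (T - t₀) + bi * Wi * (T - ti) + bk * Wk * (T - tk) + bj * Wj * (T - tj)) - ((-a) * W₀ * (T - t₀) ^ 2 + bi * Wi * (T - ti) ^ 2 + bk * Wk * (T - tk) ^ 2 + bj * Wj * (T - tj) ^ 2) := by
  refine ⟨by ring, by ring, by ring, by ring, by ring, by ring⟩


/-! ## 6. The fold derivative: the cubic form `𝒞_W` -/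

/-- **THE FOLD DERIVATIVE (abstract symbols).**  If `q·(λ·S₂) = −2S₁` (the `q`-equation at a critical point of `Ξ`, i.e. the differentiated (E2) with
`ξ = 0`) and `A·S₂ = 2S₁²` (the fold relation `𝒥 = 0`), `S₂ ≠ 0`, `λ ≠ 0`, then the `T`-derivative of `𝒥 = 2S₁² − AS₂` along the branch,
`𝒥′ = 4S₁·S₁′ − A′·S₂ − A·S₂′` with `S₁′ = q(cS₁+λB₂) + B₀`, `A′ = q(cA+λB₀)`, `S₂′ = q(cS₂+λB₃) + 2B₂` (§5), satisfies
`S₂²·𝒥′ = 2S₁·(3B₀S₂² − 6B₂S₁S₂ + 2B₃S₁²)`; the constant `c` drops out. [folklore] -/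
theorem indexFormDeriv_at_fold {S₁ S₂ A B₀ B₂ B₃ q lam c : ℝ} (hS₂ : S₂ ≠ 0) (hlam : lam ≠ 0)
    (hq : q * (lam * S₂) = -2 * S₁) (hfold : A * S₂ = 2 * S₁ ^ 2) :
    S₂ ^ 2 * (4 * S₁ * (q * (c * S₁ + lam * B₂) + B₀) - q * (c * A + lam * B₀) * S₂ - A * (q * (c * S₂ + lam * B₃) + 2 * B₂))
      = 2 * S₁ * (3 * B₀ * S₂ ^ 2 - 6 * B₂ * S₁ * S₂ + 2 * B₃ * S₁ ^ 2) := by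
  have hS₁ : S₁ = -(q * lam * S₂) / 2 := by
    field_simp
    linarith
  have hA : A = 2 * S₁ ^ 2 / S₂ := by
    field_simp
    linarith
  rw [hA, hS₁]
  field_simp
  ring

/-- **THE FOLD DERIVATIVE, four-letter form.**  Same statement with the sums spelled out (`B₀ = ∑βₘWₘ`, `B₂ = ∑βₘ²Wₘuₘ`, `B₃ = ∑βₘ³Wₘuₘ²`). [folklore] -/
theorem indexFormDeriv_at_fold_four (W₀ Wi Wk Wj a bi bk bj t₀ ti tk tj T c lam q : ℝ)
    (hS₂ : ((-a) ^ 2 * W₀ * (T - t₀) ^ 2 + bi ^ 2 * Wi * (T - ti) ^ 2 + bk ^ 2 * Wk * (T - tk) ^ 2 + bj ^ 2 * Wj * (T - tj) ^ 2) ≠ 0) (hlam : lam ≠ 0)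
    (hq : q * (lam * ((-a) ^ 2 * W₀ * (T - t₀) ^ 2 + bi ^ 2 * Wi * (T - ti) ^ 2 + bk ^ 2 * Wk * (T - tk) ^ 2 + bj ^ 2 * Wj * (T - tj) ^ 2)) = -2 * ((-a) * W₀ * (T - t₀) + bi * Wi * (T - ti) + bk * Wk * (T - tk) + bj * Wj * (T - tj)))
    (hfold : (W₀ + Wi + Wk + Wj) * ((-a) ^ 2 * W₀ * (T - t₀) ^ 2 + bi ^ 2 * Wi * (T - ti) ^ 2 + bk ^ 2 * Wk * (T - tk) ^ 2 + bj ^ 2 * Wj * (T - tj) ^ 2) = 2 * ((-a) * W₀ * (T - t₀) + bi * Wi * (T - ti) + bk * Wk * (T - tk) + bj * Wj * (T - tj)) ^ 2) :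
    ((-a) ^ 2 * W₀ * (T - t₀) ^ 2 + bi ^ 2 * Wi * (T - ti) ^ 2 + bk ^ 2 * Wk * (T - tk) ^ 2 + bj ^ 2 * Wj * (T - tj) ^ 2) ^ 2 * (4 * ((-a) * W₀ * (T - t₀) + bi * Wi * (T - ti) + bk * Wk * (T - tk) + bj * Wj * (T - tj)) * (q * (c * ((-a) * W₀ * (T - t₀) + bi * Wi * (T - ti) + bk * Wk * (T - tk) + bj * Wj * (T - tj)) + lam * ((-a) ^ 2 * W₀ * (T - t₀) + bi ^ 2 * Wi * (T - ti) + bk ^ 2 * Wk * (T - tk) + bj ^ 2 * Wj * (T - tj))) + ((-a) * W₀ + bi * Wi + bk * Wk + bj * Wj)) - q * (c * (W₀ + Wi + Wk + Wj) + lam * ((-a) * W₀ + bi * Wi + bk * Wk + bj * Wj)) * ((-a) ^ 2 * W₀ * (T - t₀) ^ 2 + bi ^ 2 * Wi * (T - ti) ^ 2 + bk ^ 2 * Wk * (T - tk) ^ 2 + bj ^ 2 * Wj * (T - tj) ^ 2)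
        - (W₀ + Wi + Wk + Wj) * (q * (c * ((-a) ^ 2 * W₀ * (T - t₀) ^ 2 + bi ^ 2 * Wi * (T - ti) ^ 2 + bk ^ 2 * Wk * (T - tk) ^ 2 + bj ^ 2 * Wj * (T - tj) ^ 2) + lam * ((-a) ^ 3 * W₀ * (T - t₀) ^ 2 + bi ^ 3 * Wi * (T - ti) ^ 2 + bk ^ 3 * Wk * (T - tk) ^ 2 + bj ^ 3 * Wj * (T - tj) ^ 2)) + 2 * ((-a) ^ 2 * W₀ * (T - t₀) + bi ^ 2 * Wi * (T - ti) + bk ^ 2 * Wk * (T - tk) + bj ^ 2 * Wj * (T - tj))))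
      = 2 * ((-a) * W₀ * (T - t₀) + bi * Wi * (T - ti) + bk * Wk * (T - tk) + bj * Wj * (T - tj)) * (3 * ((-a) * W₀ + bi * Wi + bk * Wk + bj * Wj) * ((-a) ^ 2 * W₀ * (T - t₀) ^ 2 + bi ^ 2 * Wi * (T - ti) ^ 2 + bk ^ 2 * Wk * (T - tk) ^ 2 + bj ^ 2 * Wj * (T - tj) ^ 2) ^ 2 - 6 * ((-a) ^ 2 * W₀ * (T - t₀) + bi ^ 2 * Wi * (T - ti) + bk ^ 2 * Wk * (T - tk) + bj ^ 2 * Wj * (T - tj)) * ((-a) * W₀ * (T - t₀) + bi * Wi * (T - ti) + bk * Wk * (T - tk) + bj * Wj * (T - tj)) * ((-a) ^ 2 * W₀ * (T - t₀) ^ 2 + bi ^ 2 * Wi * (T - ti) ^ 2 + bk ^ 2 * Wk * (T - tk) ^ 2 + bj ^ 2 * Wj * (T - tj) ^ 2) + 2 * ((-a) ^ 3 * W₀ * (T - t₀) ^ 2 + bi ^ 3 * Wi * (T - ti) ^ 2 + bk ^ 3 * Wk * (T - tk) ^ 2 + bj ^ 3 * Wj * (T - tj) ^ 2) * ((-a)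 * W₀ * (T - t₀) + bi * Wi * (T - ti) + bk * Wk * (T - tk) + bj * Wj * (T - tj)) ^ 2) :=
  indexFormDeriv_at_fold hS₂ hlam hq hfold


end Summit.ValiantsHypothesis.ValiantsHypothesis.Theorems.LacunarySymmetroidMatrixDescartes.Pivot.CriticalWindows.Four
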